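import Summits.QuantumFields.YangMills.Theorems.BalabanUVNodesN15CovariantLandauGradDiffRow
import Summits.QuantumFields.YangMills.Theorems.BalabanUVNodesN15CovariantLandauLetterFromFlat
import HarnessLib

/-!
# Route «BalabanUVNodes», node N15 = NE2, road (c) — PROGRAMME (P-S), XXII: THE GLOBAL ROW OF THE LANDAU PERTURBATION LETTER `N_V^R` FROM THE FOUR FLAT ROWS AND THE TRANSPORTER LETTERS
# ONLY — n15-c∕217 with its one displayed covariant row `D_TG′(T) − ∂G′(1)` DISCHARGED by the Leibniz route (n15-c∕228–230) (dag-n15-c g23, n15-c∕231)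

Cell `pub-ymgap`, seat `pub-ymgap-dag-n15-c` (generation g23; R134 (a), s1; HUMAN RULING D-0062; chair R424 venue).  `bears_on: R4∕N15 · K3⁸ SpineGivenEndpointR13SepCoPHV
(stmt-QuantumFields-27366)`; filed `--supports stmt-QuantumFields-27366 --as helper` — COUNT-NEUTRAL.  Four bookkeeping `def`s (constants) + one theorem; 0 `sorry`.  Imports BY NAME n15-c∕228
(`hasMaj_cGreen_of_flat'`), 229 (`hasMaj_cgrad_one_cGreen_of_flat'`), 230 (`hasMaj_cgrad_cGreen_sub_of_flat'`), 217 (`hasMaj_landauCov_sub_of_flat`, `landauSmallConst`, `landauRowConst`),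
n15-c∕182a (`rows∕cols_le_of_rows∕cols_sub_one` through 217).  Nothing in the tree is modified.

WHY.  n15-c∕217 reduces the global row of `landauCov T a − landauCov 1 a` to the four FLAT rows, the letters and ONE covariant row `hδD`; n15-c∕230 proves `hδD` from the flat `∂G′(1)`, the
rows of `G′(T)`, `∂G′(T)` (228–229, themselves from flat rows + letters) and the letters `ρ` (size of `T − 1`), `λ` (Lipschitz letter of `T`), `σ` (staircases).  THIS FILE chains them: at
the base rate `δ′ = δ/2` (`s = δ/8`), with `X ≤ 2C_G`, `Y ≤ 2(C_D + c_A·2C_G·c)` under the smallness `(2c_Xc + 2c_Yc + C_σ)·r ≤ 1`, the covariant row has constant `c_P·r`; then 217.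
* `cXL`, `cYL`, `cAL`, `cPL` (explicit constants); ★★★ **`hasMaj_landauCov_sub_of_flat''`** — hypotheses: the four flat rows at rate `δ`, the letters with their `r`-scalings
  (`nρ ≤ C_ρr`, `n·(nλ) ≤ C_λr`, `σ ≤ C_σr`), `|a|n^{−(d+1)} ≤ α`, two smallness conditions; NO covariant propagator row.

HONEST FRAMING ∕ LIMITS.  Bookkeeping; the four flat rows are HYPOTHESES here (theorems on King's torus family ∕ every torus by n15-c∕220, 222b); MODEL carriers; NOT
[Balaban1985BackgroundPropagators] (3.49) ∕ Thms 3.1–3.4 as printed; NE2⁺ NOT PRINTED; N15 of record untouched (DISCHARGED AS CONSUMED, p687738); counts UNMOVED (typed 28∕28 · discharged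
8∕27); one finite 𝕋⁴ at fixed ε per index — NOT infinite volume ∕ OS ∕ mass gap ∕ Clay.  Restate-immune (no Theses import).
-/

noncomputable section

open scoped BigOperators Matrix
open Finset

namespace Summit.QuantumFields.YangMills.BalabanUVNodes.N15.CovLandau

open Literature.MathematicalPhysics.QuantumFieldTheory.Balaban1983to89
open Literature.MathematicalPhysics.QuantumFieldTheory.Balaban1983to89.B5Prop11Plancherel (Tor fine unitVec)
open Literature.MathematicalPhysics.QuantumFieldTheory.Balaban1983to89.B11SectG (BlockNorm HasMaj RowSum)
open Literature.MathematicalPhysics.QuantumFieldTheory.Balaban1983to89.B6UnitTorusCarrier (unitTorusGeo rowSum_unitTorusGeo unitTorusGeo_dist_nonneg)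
open Literature.MathematicalPhysics.QuantumFieldTheory.King1986.Torus (blockOf tdistT)
open Summit.QuantumFields.YangMills.BalabanUVNodes.N15.MatrixSpecies (liftBlk)
open Summit.QuantumFields.YangMills.BalabanUVNodes.N15.CovAvg (cvaStair cvaStair_one rows_le_of_rows_sub_one cols_le_of_cols_sub_one)

variable {d : ℕ}

section Consts

/-- `c_X`: `θ_K ≤ c_X·r` for n15-c∕228's small operator. [folklore] -/
def cXL (D cG cA Cρ Cl Cσ α c δ s : ℝ) : ℝ :=
  cA * Cρ * Real.exp δ * c + cG * (D * Cl) + cA * Cρ + cG * ((D * Cρ * Real.exp (δ + s)) * (Cρ * Real.exp (δ + s)) * c) * c + α * (cG * (3 * Cσ))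

/-- `c_Y`: `θ₂ ≤ c_Y·r` for n15-c∕229's small operator. [folklore] -/
def cYL (D cD Cρ c δ : ℝ) : ℝ := cD * (D * Cρ * Real.exp δ) * c + cD * (D * Cρ)

/-- `c_A`: `A₂ − C_D ≤ c_A·r·X·c` (229) and the bracket of 230. [folklore] -/
def cAL (D cD Cρ Cl Cσ α c δ s : ℝ) : ℝ := cD * (D * Cl) + cD * ((D * Cρ * Real.exp (δ + s)) * (Cρ * Real.exp (δ + s)) * c) * c + α * (cD * (2 * Cσ)) + α * (cD * Cσ)

/-- `c_P`: the covariant gradient-difference row is `≤ c_P·r` (with `X = 2C_G`, `Y = 2(C_D + c_A·2C_G·c)`). [folklore] -/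
def cPL (D cG cD Cρ Cl Cσ α c δ s : ℝ) : ℝ :=
  cAL D cD Cρ Cl Cσ α c δ s * (2 * cG) * c + cYL D cD Cρ c δ * (2 * (cD + cAL D cD Cρ Cl Cσ α c δ s * (2 * cG) * c)) * c + Cρ * Real.exp (δ + s) * (2 * cG) * c

end Consts

section Main

variable (M : Fin (d + 1) → ℕ) [∀ μ, NeZero (M μ)] (n : ℕ) [NeZero n] {ι : Type} [Fintype ι] [DecidableEq ι] (L k : ℕ)

set_option maxHeartbeats 1600000 in
/-- ★★★ **THE GLOBAL ROW OF THE LANDAU PERTURBATION LETTER FROM THE FOUR FLAT ROWS AND THE TRANSPORTER LETTERS ONLY** (`s = δ/8`, `c = c(δ/8)`, base rate `δ/2` for n15-c∕217).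
[cite: Balaban1985BackgroundPropagators, (3.49) p.399, Thm 3.1 (3.42) p.397, Thm 3.4 p.400, Lemma 3.3 p.402; Balaban1984PropagatorsII, (2.52)–(2.56) pp.232–233] -/
theorem hasMaj_landauCov_sub_of_flat'' {T : Fin (d + 1) → Tor (fine n M) → Matrix ι ι ℝ} (hT : ∀ ν x, IsUnit (T ν x)) {a : ℝ} (ha : 0 < a)
    {δ CG CA CD CS Cρ Cl Cσ α r ρ lam σ : ℝ} (hδ : 0 < δ) (hCG : 0 ≤ CG) (hCA : 0 ≤ CA) (hCD : 0 ≤ CD) (hCS : 0 ≤ CS) (hCρ : 0 ≤ Cρ) (hCl : 0 ≤ Cl) (hCσ : 0 ≤ Cσ) (hα : 0 ≤ α)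
    (hr0 : 0 ≤ r) (hr1 : r ≤ 1) (hρ0 : 0 ≤ ρ) (hlam0 : 0 ≤ lam) (hσ0 : 0 ≤ σ) (haα : |a| * ((n : ℝ) ^ (d + 1))⁻¹ ≤ α)
    (hρr : ∀ ν x i, ∑ j, |(T ν x - (fun (_ : Fin (d + 1)) (_ : Tor (fine n M)) => (1 : Matrix ι ι ℝ)) ν x) i j| ≤ ρ)
    (hρc : ∀ ν x j, ∑ i, |(T ν x - (fun (_ : Fin (d + 1)) (_ : Tor (fine n M)) => (1 : Matrix ι ι ℝ)) ν x) i j| ≤ ρ)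
    (hlamr : ∀ μ (z : Tor (fine n M)) i, ∑ j, |(T μ z - T μ (z - unitVec (fine n M) μ)) i j| ≤ lam)
    (hlamc : ∀ μ (z : Tor (fine n M)) i, ∑ j, |(T μ z - T μ (z - unitVec (fine n M) μ)) j i| ≤ lam)
    (hσr : ∀ y a' i, ∑ j, |(cvaStair M n (fun μ b => T μ b.1) y a' 0 - cvaStair M n (fun μ b => (fun (_ : Fin (d + 1)) (_ : Tor (fine n M)) => (1 : Matrix ι ι ℝ)) μ b.1) y a' 0) i j| ≤ σ)
    (hσc : ∀ y a' j, ∑ i, |(cvaStair M n (fun μ b => T μ b.1) y a' 0 - cvaStair M n (fun μ b => (fun (_ : Fin (d + 1)) (_ : Tor (fine n M)) => (1 : Matrix ι ι ℝ)) μ b.1) y a' 0) i j| ≤ σ)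
    (hnρ : (n : ℝ) * ρ ≤ Cρ * r) (hnlam : (n : ℝ) * ((n : ℝ) * lam) ≤ Cl * r) (hσle : σ ≤ Cσ * r)
    (hG1 : HasMaj (BlockNorm.ofBlocks (unitTorusGeo L k M) (liftBlk (blockOf n M) ι)) (BlockNorm.ofBlocks (unitTorusGeo L k M) (liftBlk (blockOf n M) ι)) (Matrix.mulVecLin (cGreen M n (fun (_ : Fin (d + 1)) (_ : Tor (fine n M)) => (1 : Matrix ι ι ℝ)) a)) (fun y y' => CG * Real.exp (-(δ * tdistT M y y'))))
    (hA1 : HasMaj (BlockNorm.ofBlocks (unitTorusGeo L k M) (liftBlk (fun b : Tor (fine n M) × Fin (d + 1) => blockOf n M b.1) ι)) (BlockNorm.ofBlocks (unitTorusGeo L k M) (liftBlk (blockOf n M) ι)) (Matrix.mulVecLin ((cGreen M n (fun (_ : Fin (d + 1)) (_ : Tor (fine n M)) => (1 : Matrix ι ι ℝ)) a) * (cgrad M n (fun (_ : Fin (d + 1)) (_ : Tor (fine n M)) => (1 : Matrix ι ι ℝ)))ᵀ)) (fun y y' => CA * Real.exp (-(δ * tdistT M y y'))))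
    (hD1 : HasMaj (BlockNorm.ofBlocks (unitTorusGeo L k M) (liftBlk (blockOf n M) ι)) (BlockNorm.ofBlocks (unitTorusGeo L k M) (liftBlk (fun b : Tor (fine n M) × Fin (d + 1) => blockOf n M b.1) ι)) (Matrix.mulVecLin ((cgrad M n (fun (_ : Fin (d + 1)) (_ : Tor (fine n M)) => (1 : Matrix ι ι ℝ))) * (cGreen M n (fun (_ : Fin (d + 1)) (_ : Tor (fine n M)) => (1 : Matrix ι ι ℝ)) a))) (fun y y' => CD * Real.exp (-(δ * tdistT M y y'))))
    (hS1 : HasMaj (BlockNorm.ofBlocks (unitTorusGeo L k M) (liftBlk (fun y : Tor M => y) ι)) (BlockNorm.ofBlocks (unitTorusGeo L k M) (liftBlk (fun y : Tor M => y) ι)) (Matrix.mulVecLin (cSop M n (fun (_ : Fin (d + 1)) (_ : Tor (fine n M)) => (1 : Matrix ι ι ℝ)) a)⁻¹) (fun y y' => CS * (n : ℝ) ^ (d + 1) * Real.exp (-(δ * tdistT M y y'))))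
    (hsmallL : (2 * cXL ((d : ℝ) + 1) CG CA Cρ Cl Cσ α (B4Sect5Proof.latticeConst (d + 1) (δ / 8)) δ (δ / 8) * B4Sect5Proof.latticeConst (d + 1) (δ / 8)
        + 2 * cYL ((d : ℝ) + 1) CD Cρ (B4Sect5Proof.latticeConst (d + 1) (δ / 8)) δ * B4Sect5Proof.latticeConst (d + 1) (δ / 8) + Cσ) * r ≤ 1)
    (hsmall : landauSmallConst ((d : ℝ) + 1) (Fintype.card ι) CG CA CD CS (cPL ((d : ℝ) + 1) CG CD Cρ Cl Cσ α (B4Sect5Proof.latticeConst (d + 1) (δ / 8)) δ (δ / 8)) Cρ Cσ α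
        (B4Sect5Proof.latticeConst (d + 1) (δ / 2 / 16)) (δ / 2) * r ≤ 1) :
    HasMaj (BlockNorm.ofBlocks (unitTorusGeo L k M) (liftBlk (fun b : Tor (fine n M) × Fin (d + 1) => blockOf n M b.1) ι)) (BlockNorm.ofBlocks (unitTorusGeo L k M) (liftBlk (fun b : Tor (fine n M) × Fin (d + 1) => blockOf n M b.1) ι)) (Matrix.mulVecLin (landauCov M n T a - landauCov M n (fun (_ : Fin (d + 1)) (_ : Tor (fine n M)) => (1 : Matrix ι ι ℝ)) a))
      (fun y y' => landauRowConst ((d : ℝ) + 1) (Fintype.card ι) CG CA CD CS (cPL ((d : ℝ) + 1) CG CD Cρ Cl Cσ α (B4Sect5Proof.latticeConst (d + 1) (δ / 8)) δ (δ / 8)) Cρ Cσ α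
        (B4Sect5Proof.latticeConst (d + 1) (δ / 2 / 16)) (B4Sect5Proof.latticeConst (d + 1) (3 * (δ / 2) / 4 / 8)) (δ / 2) * r * Real.exp (-((3 * (δ / 2) / 8) * tdistT M y y'))) := by
  have hn : (0 : ℝ) < (n : ℝ) ^ (d + 1) := pow_pos (Nat.cast_pos.mpr (Nat.pos_of_ne_zero (NeZero.ne n))) _
  have hn1 : (0 : ℝ) ≤ (n : ℝ) := Nat.cast_nonneg n
  have hd := unitTorusGeo_dist_nonneg L k M
  set s : ℝ := δ / 8 with hsdef
  have hs : 0 < s := by positivity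
  set c : ℝ := B4Sect5Proof.latticeConst (d + 1) s with hcdef
  have hrow : RowSum (unitTorusGeo L k M) s c := rowSum_unitTorusGeo L k M hs
  have hc : 0 ≤ c := B4Sect5Proof.latticeConst_nonneg (d + 1) hs.le
  have hD : (0 : ℝ) ≤ ((d : ℝ) + 1) := by positivity
  obtain ⟨KX, hKXdef⟩ : ∃ x : ℝ, x = cXL ((d : ℝ) + 1) CG CA Cρ Cl Cσ α c δ s := ⟨_, rfl⟩
  have hKX : 0 ≤ KX := by rw [hKXdef]; unfold cXL; positivity
  obtain ⟨KY, hKYdef⟩ : ∃ x : ℝ, x = cYL ((d : ℝ) + 1) CD Cρ c δ := ⟨_, rfl⟩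
  have hKY : 0 ≤ KY := by rw [hKYdef]; unfold cYL; positivity
  obtain ⟨KA, hKAdef⟩ : ∃ x : ℝ, x = cAL ((d : ℝ) + 1) CD Cρ Cl Cσ α c δ s := ⟨_, rfl⟩
  have hKA : 0 ≤ KA := by rw [hKAdef]; unfold cAL; positivity
  obtain ⟨KP, hKPdef⟩ : ∃ x : ℝ, x = cPL ((d : ℝ) + 1) CG CD Cρ Cl Cσ α c δ s := ⟨_, rfl⟩
  have hKPeq : KP = KA * (2 * CG) * c + KY * (2 * (CD + KA * (2 * CG) * c)) * c + Cρ * Real.exp (δ + s) * (2 * CG) * c := by rw [hKPdef, hKAdef, hKYdef]; rfl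
  have hKP : 0 ≤ KP := by rw [hKPeq]; positivity
  -- smallness consequences
  have hsm' : (2 * KX * c + 2 * KY * c + Cσ) * r ≤ 1 := by rw [hKXdef, hKYdef]; exact hsmallL
  have hXc0 : 0 ≤ 2 * KX * c := by positivity
  have hYc0 : 0 ≤ 2 * KY * c := by positivity
  have hq1 : KX * c * r ≤ 1 / 2 := by nlinarith only [hsm', hXc0, hYc0, hCσ, hr0]
  have hq2 : KY * c * r ≤ 1 / 2 := by nlinarith only [hsm', hXc0, hYc0, hCσ, hr0]
  have hσ1 : σ ≤ 1 := hσle.trans (by nlinarith only [hsm', hXc0, hYc0, hCσ, hr0])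
  -- letters: `τ = 1 + σ ≤ 2`, the `r`-scalings of the composite letters
  have e1 : ∀ (y : Tor M) (a' : Fin (d + 1) → Fin n), cvaStair M n (fun μ (b : Tor (fine n M) × Fin (d + 1)) => (fun (_ : Fin (d + 1)) (_ : Tor (fine n M)) => (1 : Matrix ι ι ℝ)) μ b.1) y a' 0 = 1 := fun y a' => cvaStair_one M n y a' 0
  have hτr : ∀ y a' i, ∑ j, |cvaStair M n (fun μ b => T μ b.1) y a' 0 i j| ≤ 1 + σ := fun y a' i =>
    rows_le_of_rows_sub_one (A := cvaStair M n (fun μ b => T μ b.1) y a' 0) (fun i' => by have h := hσr y a' i'; rwa [e1] at h) i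
  have hτ0 : (0 : ℝ) ≤ 1 + σ := by positivity
  have hτ2 : 1 + σ ≤ 2 := by linarith only [hσ1]
  have hDρ : (n : ℝ) * (((d + 1 : ℕ) : ℝ) * ρ) ≤ ((d : ℝ) + 1) * (Cρ * r) := by
    calc (n : ℝ) * (((d + 1 : ℕ) : ℝ) * ρ) = ((d : ℝ) + 1) * ((n : ℝ) * ρ) := by push_cast; ring
      _ ≤ ((d : ℝ) + 1) * (Cρ * r) := mul_le_mul_of_nonneg_left hnρ hD
  have hCρr : Cρ * r ≤ Cρ := mul_le_of_le_one_right hCρ hr1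
  have hee : ((n : ℝ) * (((d + 1 : ℕ) : ℝ) * ρ) * Real.exp (δ + s)) * ((n : ℝ) * ρ * Real.exp (δ + s)) * c ≤ ((((d : ℝ) + 1) * Cρ * Real.exp (δ + s)) * (Cρ * Real.exp (δ + s)) * c) * r := by
    have t1 : (n : ℝ) * (((d + 1 : ℕ) : ℝ) * ρ) * Real.exp (δ + s) ≤ ((d : ℝ) + 1) * Cρ * Real.exp (δ + s) :=
      mul_le_mul_of_nonneg_right (hDρ.trans (by nlinarith only [hCρr, hD])) (Real.exp_pos _).le
    have t2 : (n : ℝ) * ρ * Real.exp (δ + s) ≤ Cρ * r * Real.exp (δ + s) := mul_le_mul_of_nonneg_right hnρ (Real.exp_pos _).le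
    calc _ ≤ (((d : ℝ) + 1) * Cρ * Real.exp (δ + s)) * (Cρ * r * Real.exp (δ + s)) * c := by gcongr
      _ = _ := by ring
  have hστ : ((n : ℝ) ^ (d + 1))⁻¹ * CG * (σ * (1 + σ) + σ) ≤ ((n : ℝ) ^ (d + 1))⁻¹ * (CG * (3 * (Cσ * r))) := by
    have h3 : σ * (1 + σ) + σ ≤ 3 * (Cσ * r) := by
      have : σ * (1 + σ) ≤ σ * 2 := mul_le_mul_of_nonneg_left hτ2 hσ0
      linarith only [this, hσle]
    calc _ = ((n : ℝ) ^ (d + 1))⁻¹ * (CG * (σ * (1 + σ) + σ)) := by ring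
      _ ≤ _ := mul_le_mul_of_nonneg_left (mul_le_mul_of_nonneg_left h3 hCG) (inv_nonneg.mpr hn.le)
  -- STEP 1 (228): the row of `G′(T)`
  have hθK : CA * ((n : ℝ) * ρ * Real.exp δ) * c + CG * (((d : ℝ) + 1) * (n : ℝ) * ((n : ℝ) * lam)) + CA * ((n : ℝ) * ρ)
      + CG * (((n : ℝ) * ((d + 1 : ℕ) * ρ) * Real.exp (δ + s)) * ((n : ℝ) * ρ * Real.exp (δ + s)) * c) * c + |a| * (((n : ℝ) ^ (d + 1))⁻¹ * CG * (σ * (1 + σ) + σ)) ≤ KX * r := by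
    have h1 : CA * ((n : ℝ) * ρ * Real.exp δ) * c ≤ CA * (Cρ * r * Real.exp δ) * c := by gcongr
    have h2 : CG * (((d : ℝ) + 1) * (n : ℝ) * ((n : ℝ) * lam)) ≤ CG * (((d : ℝ) + 1) * (Cl * r)) := by
      rw [mul_assoc ((d : ℝ) + 1)]; exact mul_le_mul_of_nonneg_left (mul_le_mul_of_nonneg_left hnlam hD) hCG
    have h3 : CA * ((n : ℝ) * ρ) ≤ CA * (Cρ * r) := mul_le_mul_of_nonneg_left hnρ hCA
    have h4 : CG * (((n : ℝ) * ((d + 1 : ℕ) * ρ) * Real.exp (δ + s)) * ((n : ℝ) * ρ * Real.exp (δ + s)) * c) * c ≤ CG * (((((d : ℝ) + 1) * Cρ * Real.exp (δ + s)) * (Cρ * Real.exp (δ + s)) * c) * r) * c :=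
      mul_le_mul_of_nonneg_right (mul_le_mul_of_nonneg_left hee hCG) hc
    have h5 : |a| * (((n : ℝ) ^ (d + 1))⁻¹ * CG * (σ * (1 + σ) + σ)) ≤ α * (CG * (3 * (Cσ * r))) := by
      calc |a| * (((n : ℝ) ^ (d + 1))⁻¹ * CG * (σ * (1 + σ) + σ)) ≤ |a| * (((n : ℝ) ^ (d + 1))⁻¹ * (CG * (3 * (Cσ * r)))) := mul_le_mul_of_nonneg_left hστ (abs_nonneg a)
        _ = (|a| * ((n : ℝ) ^ (d + 1))⁻¹) * (CG * (3 * (Cσ * r))) := by ring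
        _ ≤ α * (CG * (3 * (Cσ * r))) := mul_le_mul_of_nonneg_right haα (by positivity)
    calc _ ≤ CA * (Cρ * r * Real.exp δ) * c + CG * (((d : ℝ) + 1) * (Cl * r)) + CA * (Cρ * r) + CG * (((((d : ℝ) + 1) * Cρ * Real.exp (δ + s)) * (Cρ * Real.exp (δ + s)) * c) * r) * c + α * (CG * (3 * (Cσ * r))) := by
          linarith only [h1, h2, h3, h4, h5]
      _ = KX * r := by rw [hKXdef]; unfold cXL; ring
  have hθKc : (CA * ((n : ℝ) * ρ * Real.exp δ) * c + CG * (((d : ℝ) + 1) * (n : ℝ) * ((n : ℝ) * lam)) + CA * ((n : ℝ) * ρ)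
      + CG * (((n : ℝ) * ((d + 1 : ℕ) * ρ) * Real.exp (δ + s)) * ((n : ℝ) * ρ * Real.exp (δ + s)) * c) * c + |a| * (((n : ℝ) ^ (d + 1))⁻¹ * CG * (σ * (1 + σ) + σ))) * c ≤ 1 / 2 :=
    (mul_le_mul_of_nonneg_right hθK hc).trans (by linarith only [hq1, show KX * r * c = KX * c * r by ring])
  have hX0 := hasMaj_cGreen_of_flat' M n L k hT ha hs (by linarith) hrow hc hCG hCA hρ0 hlam0 hσ0 hτ0 hρr hρc hlamc hσr hσc hτr hG1 hA1 (by linarith only [hθKc])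
  have hX : HasMaj (BlockNorm.ofBlocks (unitTorusGeo L k M) (liftBlk (blockOf n M) ι)) (BlockNorm.ofBlocks (unitTorusGeo L k M) (liftBlk (blockOf n M) ι)) (Matrix.mulVecLin (cGreen M n T a)) (fun y y' => (2 * CG) * Real.exp (-((δ - 2 * s) * tdistT M y y'))) := by
    refine hX0.mono fun y y' => mul_le_mul_of_nonneg_right ?_ (Real.exp_nonneg _)
    have hinv : (1 - (CA * ((n : ℝ) * ρ * Real.exp δ) * c + CG * (((d : ℝ) + 1) * (n : ℝ) * ((n : ℝ) * lam)) + CA * ((n : ℝ) * ρ)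
        + CG * (((n : ℝ) * ((d + 1 : ℕ) * ρ) * Real.exp (δ + s)) * ((n : ℝ) * ρ * Real.exp (δ + s)) * c) * c + |a| * (((n : ℝ) ^ (d + 1))⁻¹ * CG * (σ * (1 + σ) + σ))) * c)⁻¹ ≤ 2 := by
      calc _ ≤ (1 / 2 : ℝ)⁻¹ := inv_anti₀ (by norm_num) (by linarith only [hθKc])
        _ = 2 := by norm_num
    calc _ ≤ CG * 2 := mul_le_mul_of_nonneg_left hinv hCG
      _ = 2 * CG := mul_comm _ _
  -- STEP 2 (229): the row of `∂G′(T)`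
  have hθ2 : CD * ((n : ℝ) * ((d + 1 : ℕ) * ρ) * Real.exp δ) * c + CD * (((d : ℝ) + 1) * ((n : ℝ) * ρ)) ≤ KY * r := by
    have h1 : CD * ((n : ℝ) * ((d + 1 : ℕ) * ρ) * Real.exp δ) * c ≤ CD * ((((d : ℝ) + 1) * (Cρ * r)) * Real.exp δ) * c := by gcongr
    have h2 : CD * (((d : ℝ) + 1) * ((n : ℝ) * ρ)) ≤ CD * (((d : ℝ) + 1) * (Cρ * r)) := by gcongr
    calc _ ≤ CD * ((((d : ℝ) + 1) * (Cρ * r)) * Real.exp δ) * c + CD * (((d : ℝ) + 1) * (Cρ * r)) := add_le_add h1 h2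
      _ = KY * r := by rw [hKYdef]; unfold cYL; ring
  have hθ2c : (CD * ((n : ℝ) * ((d + 1 : ℕ) * ρ) * Real.exp δ) * c + CD * (((d : ℝ) + 1) * ((n : ℝ) * ρ))) * c ≤ 1 / 2 :=
    (mul_le_mul_of_nonneg_right hθ2 hc).trans (by linarith only [hq2, show KY * r * c = KY * c * r by ring])
  have hY0 := hasMaj_cgrad_one_cGreen_of_flat' M n L k hT ha hs (by linarith) hrow hc hCD (by positivity : 0 ≤ 2 * CG) hρ0 hlam0 hσ0 hτ0 hρr hρc hlamr hσr hσc hτr hD1 hX (by linarith only [hθ2c])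
  -- the bracket `A₂ − C_D ≤ c_A·r·X·c` (with `X = 2C_G`)
  have hbr : CD * (((d : ℝ) + 1) * (n : ℝ) * ((n : ℝ) * lam)) * (2 * CG) * c + CD * (((n : ℝ) * ((d + 1 : ℕ) * ρ) * Real.exp (δ + s)) * ((n : ℝ) * ρ * Real.exp (δ + s)) * c) * c * (2 * CG) * c
      + |a| * (CD * (((n : ℝ) ^ (d + 1))⁻¹ * σ * (1 + σ))) * (2 * CG) * c + |a| * (CD * (((n : ℝ) ^ (d + 1))⁻¹ * 1 * σ)) * (2 * CG) * c ≤ KA * r * (2 * CG) * c := by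
    have h1 : CD * (((d : ℝ) + 1) * (n : ℝ) * ((n : ℝ) * lam)) ≤ CD * (((d : ℝ) + 1) * (Cl * r)) := by
      rw [mul_assoc ((d : ℝ) + 1)]; exact mul_le_mul_of_nonneg_left (mul_le_mul_of_nonneg_left hnlam hD) hCD
    have h2 : CD * (((n : ℝ) * ((d + 1 : ℕ) * ρ) * Real.exp (δ + s)) * ((n : ℝ) * ρ * Real.exp (δ + s)) * c) * c ≤ CD * (((((d : ℝ) + 1) * Cρ * Real.exp (δ + s)) * (Cρ * Real.exp (δ + s)) * c) * r) * c :=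
      mul_le_mul_of_nonneg_right (mul_le_mul_of_nonneg_left hee hCD) hc
    have h3 : |a| * (CD * (((n : ℝ) ^ (d + 1))⁻¹ * σ * (1 + σ))) ≤ α * (CD * (2 * (Cσ * r))) := by
      have t : σ * (1 + σ) ≤ 2 * (Cσ * r) := by nlinarith only [hτ2, hσ0, hσle]
      calc |a| * (CD * (((n : ℝ) ^ (d + 1))⁻¹ * σ * (1 + σ))) = (|a| * ((n : ℝ) ^ (d + 1))⁻¹) * (CD * (σ * (1 + σ))) := by ring
        _ ≤ α * (CD * (2 * (Cσ * r))) := mul_le_mul haα (mul_le_mul_of_nonneg_left t hCD) (by positivity) hα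
    have h4 : |a| * (CD * (((n : ℝ) ^ (d + 1))⁻¹ * 1 * σ)) ≤ α * (CD * (Cσ * r)) := by
      calc |a| * (CD * (((n : ℝ) ^ (d + 1))⁻¹ * 1 * σ)) = (|a| * ((n : ℝ) ^ (d + 1))⁻¹) * (CD * σ) := by ring
        _ ≤ α * (CD * (Cσ * r)) := mul_le_mul haα (mul_le_mul_of_nonneg_left hσle hCD) (by positivity) hα
    have hG2 : 0 ≤ (2 * CG) * c := by positivity
    have s1 := mul_le_mul_of_nonneg_right h1 hG2
    have s2 := mul_le_mul_of_nonneg_right h2 hG2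
    have s3 := mul_le_mul_of_nonneg_right h3 hG2
    have s4 := mul_le_mul_of_nonneg_right h4 hG2
    calc _ = CD * (((d : ℝ) + 1) * (n : ℝ) * ((n : ℝ) * lam)) * ((2 * CG) * c) + CD * (((n : ℝ) * ((d + 1 : ℕ) * ρ) * Real.exp (δ + s)) * ((n : ℝ) * ρ * Real.exp (δ + s)) * c) * c * ((2 * CG) * c)
          + |a| * (CD * (((n : ℝ) ^ (d + 1))⁻¹ * σ * (1 + σ))) * ((2 * CG) * c) + |a| * (CD * (((n : ℝ) ^ (d + 1))⁻¹ * 1 * σ)) * ((2 * CG) * c) := by ring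
      _ ≤ CD * (((d : ℝ) + 1) * (Cl * r)) * ((2 * CG) * c) + CD * (((((d : ℝ) + 1) * Cρ * Real.exp (δ + s)) * (Cρ * Real.exp (δ + s)) * c) * r) * c * ((2 * CG) * c)
          + α * (CD * (2 * (Cσ * r))) * ((2 * CG) * c) + α * (CD * (Cσ * r)) * ((2 * CG) * c) := by linarith only [s1, s2, s3, s4]
      _ = KA * r * (2 * CG) * c := by rw [hKAdef]; unfold cAL; ring
  have hY : HasMaj (BlockNorm.ofBlocks (unitTorusGeo L k M) (liftBlk (blockOf n M) ι)) (BlockNorm.ofBlocks (unitTorusGeo L k M) (liftBlk (fun b : Tor (fine n M) × Fin (d + 1) => blockOf n M b.1) ι)) (Matrix.mulVecLin ((cgrad M n (fun (_ : Fin (d + 1)) (_ : Tor (fine n M)) => (1 : Matrix ι ι ℝ))) * (cGreen M n T a))) (fun y y' => (2 * (CD + KA * (2 * CG) * c)) * Real.exp (-((δ - 3 * s) * tdistT M y y'))) := by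
    refine hY0.mono fun y y' => mul_le_mul_of_nonneg_right ?_ (Real.exp_nonneg _)
    have hinv : (1 - (CD * ((n : ℝ) * ((d + 1 : ℕ) * ρ) * Real.exp δ) * c + CD * (((d : ℝ) + 1) * ((n : ℝ) * ρ))) * c)⁻¹ ≤ 2 := by
      calc _ ≤ (1 / 2 : ℝ)⁻¹ := inv_anti₀ (by norm_num) (by linarith only [hθ2c])
        _ = 2 := by norm_num
    have hA2 : CD + CD * (((d : ℝ) + 1) * (n : ℝ) * ((n : ℝ) * lam)) * (2 * CG) * c + CD * (((n : ℝ) * ((d + 1 : ℕ) * ρ) * Real.exp (δ + s)) * ((n : ℝ) * ρ * Real.exp (δ + s)) * c) * c * (2 * CG) * c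
        + |a| * (CD * (((n : ℝ) ^ (d + 1))⁻¹ * σ * (1 + σ))) * (2 * CG) * c + |a| * (CD * (((n : ℝ) ^ (d + 1))⁻¹ * 1 * σ)) * (2 * CG) * c ≤ CD + KA * (2 * CG) * c := by
      have : KA * r * (2 * CG) * c ≤ KA * (2 * CG) * c := by
        have := mul_le_of_le_one_right hKA hr1
        nlinarith only [this, hCG, hc, mul_nonneg hCG hc]
      linarith only [hbr, this]
    have hA20 : 0 ≤ CD + CD * (((d : ℝ) + 1) * (n : ℝ) * ((n : ℝ) * lam)) * (2 * CG) * c + CD * (((n : ℝ) * ((d + 1 : ℕ) * ρ) * Real.exp (δ + s)) * ((n : ℝ) * ρ * Real.exp (δ + s)) * c) * c * (2 * CG) * c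
        + |a| * (CD * (((n : ℝ) ^ (d + 1))⁻¹ * σ * (1 + σ))) * (2 * CG) * c + |a| * (CD * (((n : ℝ) ^ (d + 1))⁻¹ * 1 * σ)) * (2 * CG) * c := by positivity
    calc _ ≤ (CD + KA * (2 * CG) * c) * 2 := mul_le_mul hA2 hinv (inv_nonneg.mpr (by linarith only [hθ2c])) (by positivity)
      _ = 2 * (CD + KA * (2 * CG) * c) := mul_comm _ _
  -- STEP 3 (230): the covariant gradient-difference row, constant `≤ c_P·r`
  have hP0 := hasMaj_cgrad_cGreen_sub_of_flat' M n L k hT ha hs (by linarith) hrow hc hCD (by positivity : 0 ≤ 2 * CG) (by positivity : 0 ≤ 2 * (CD + KA * (2 * CG) * c)) hρ0 hlam0 hσ0 hτ0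
    hρr hρc hlamr hσr hσc hτr hD1 hX hY
  have hP : (CD * (((d : ℝ) + 1) * (n : ℝ) * ((n : ℝ) * lam)) * (2 * CG) * c + CD * (((n : ℝ) * ((d + 1 : ℕ) * ρ) * Real.exp (δ + s)) * ((n : ℝ) * ρ * Real.exp (δ + s)) * c) * c * (2 * CG) * c
          + |a| * (CD * (((n : ℝ) ^ (d + 1))⁻¹ * σ * (1 + σ))) * (2 * CG) * c + |a| * (CD * (((n : ℝ) ^ (d + 1))⁻¹ * 1 * σ)) * (2 * CG) * c)
          + (CD * ((n : ℝ) * ((d + 1 : ℕ) * ρ) * Real.exp δ) * c + CD * (((d : ℝ) + 1) * ((n : ℝ) * ρ))) * (2 * (CD + KA * (2 * CG) * c)) * c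
          + ((n : ℝ) * ρ * Real.exp (δ + s)) * (2 * CG) * c ≤ KP * r := by
    have t2 : (CD * ((n : ℝ) * ((d + 1 : ℕ) * ρ) * Real.exp δ) * c + CD * (((d : ℝ) + 1) * ((n : ℝ) * ρ))) * (2 * (CD + KA * (2 * CG) * c)) * c ≤ KY * r * (2 * (CD + KA * (2 * CG) * c)) * c :=
      mul_le_mul_of_nonneg_right (mul_le_mul_of_nonneg_right hθ2 (by positivity)) hc
    have t3 : ((n : ℝ) * ρ * Real.exp (δ + s)) * (2 * CG) * c ≤ (Cρ * r * Real.exp (δ + s)) * (2 * CG) * c := by gcongr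
    calc _ ≤ KA * r * (2 * CG) * c + KY * r * (2 * (CD + KA * (2 * CG) * c)) * c + (Cρ * r * Real.exp (δ + s)) * (2 * CG) * c := by linarith only [hbr, t2, t3]
      _ = KP * r := by rw [hKPeq]; ring
  have hδD : HasMaj (BlockNorm.ofBlocks (unitTorusGeo L k M) (liftBlk (blockOf n M) ι)) (BlockNorm.ofBlocks (unitTorusGeo L k M) (liftBlk (fun b : Tor (fine n M) × Fin (d + 1) => blockOf n M b.1) ι)) (Matrix.mulVecLin (cgrad M n T * (cGreen M n T a) - (cgrad M n (fun (_ : Fin (d + 1)) (_ : Tor (fine n M)) => (1 : Matrix ι ι ℝ))) * (cGreen M n (fun (_ : Fin (d + 1)) (_ : Tor (fine n M)) => (1 : Matrix ι ι ℝ)) a))) (fun y y' => KP * r * Real.exp (-((δ / 2) * tdistT M y y'))) := by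
    have e : δ - 4 * s = δ / 2 := by rw [hsdef]; ring
    rw [← e]
    exact hP0.mono fun y y' => mul_le_mul_of_nonneg_right hP (Real.exp_nonneg _)
  -- STEP 4 (217) at the base rate `δ/2`
  have hδ2 : 0 < δ / 2 := by positivity
  have hle : δ / 2 ≤ δ := by linarith
  have key := hasMaj_landauCov_sub_of_flat M n L k hT ha hδ2 hCG hCA hCD hCS hKP hCρ hCσ hα hr0 hr1 hρ0 hσ0 haα hρr hρc hσr hσc hnρ hσle
    (hG1.of_rate_le hd hCG hle) (hA1.of_rate_le hd hCA hle) (hD1.of_rate_le hd hCD hle) (hS1.of_rate_le hd (by positivity) hle) hδD (by rw [← hKPdef] at hsmall; exact hsmall)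
  rw [hKPdef] at key
  exact key

end Main

end Summit.QuantumFields.YangMills.BalabanUVNodes.N15.CovLandau

end
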